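import Literature.MathematicalPhysics.QuantumLattice.FinDimSpectrumProofs
import HarnessLib

/-!
# Concavity of the ground energy along affine (dial) families — pub-rhpf cand-8, row C8-N5 (a)

Long-odds mechanism/rigidity campaign bookkeeping; **no RH claims**. Elementary finite-dimensional
facts used by the look-ahead twin analysis (GAP-CLASSES row C8-N5): for Hermitian matrices the ground
energy `A.groundEnergy` (Literature `Matrix.groundEnergy`, Tasaki 2020 §2.1) is

* **concave** along segments: `t • E₀(A) + s • E₀(B) ≤ E₀(t • A + s • B)` for `t, s ≥ 0`, `t + s = 1`
  (`groundEnergy_convexCombo_ge`);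
* bounded **above by its tangent (Hellmann–Feynman) hyperplane** along any affine dial family
  `A + ∑ i, x i • P i`: `E₀(A + ∑ xᵢ Pᵢ) ≤ E₀(A) + ∑ xᵢ · re ω_A(Pᵢ)` where `ω_A` is the tracial
  ground-state functional of `A` (`groundEnergy_affineDial_le_tangent`); in particular the first-order
  onset half-space `E₀(A) + ∑ xᵢ re ω_A(Pᵢ) < 0` is EXACTLY sufficient for a negative ground level
  (`groundEnergy_affineDial_neg_of_tangent_neg`) — no second-order caveat on the onset side.

Both are one-line consequences of the variational bound `groundEnergy_le_groundStateFunctional_re`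
and `groundStateFunctional_hamiltonian` of `FinDimSpectrumProofs`. In the campaign's dictionary:
`A = Q_w^±(ζ)` is the Galerkin block of a window `w = (a, N)` in one parity sector, `P i` the block of
the prime-power term `q_i` (exact affine dial rule `Q_w(x) = Q_w(ζ) + ∑ x_q P_{q,w}`), and for a simple
ground state `re ω_A(P_q) = ⟨u₁, P_q u₁⟩` is the served Hellmann–Feynman response `q_pterms`. [folklore]
-/

namespace Summit.RiemannHypothesis.RiemannHypothesis.Theorems.PfPersistenceDialConcavity

open Matrix Literature.MathematicalPhysics.QuantumLattice
open scoped ComplexOrder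

variable {n : Type*} [Fintype n] [DecidableEq n]

omit [Fintype n] [DecidableEq n] in
/-- Hermiticity of a real convex (indeed any real-linear) combination of Hermitian matrices. [folklore] -/
theorem isHermitian_convexCombo {A B : Matrix n n ℂ} (hA : A.IsHermitian) (hB : B.IsHermitian)
    (t s : ℝ) : (t • A + s • B).IsHermitian :=
  (hA.smul (IsSelfAdjoint.all t)).add (hB.smul (IsSelfAdjoint.all s))

omit [Fintype n] [DecidableEq n] in
/-- Hermiticity of an affine dial family `A + ∑ i, x i • P i` with real dials. [folklore] -/
theorem isHermitian_affineDial {ι : Type*} (S : Finset ι) {A : Matrix n n ℂ} (hA : A.IsHermitian)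
    {P : ι → Matrix n n ℂ} (hP : ∀ i, (P i).IsHermitian) (x : ι → ℝ) :
    (A + ∑ i ∈ S, x i • P i).IsHermitian := by
  classical
  refine hA.add ?_
  induction S using Finset.induction_on with
  | empty => simp
  | insert i S hi ih =>
      rw [Finset.sum_insert hi]
      exact ((hP i).smul (IsSelfAdjoint.all (x i))).add ih

/-- The tracial ground-state functional is real-linear in the observable (real part). [folklore] -/
theorem groundStateFunctional_re_convexCombo (C A B : Matrix n n ℂ) (t s : ℝ) :
    (C.groundStateFunctional (t • A + s • B)).re
      = t * (C.groundStateFunctional A).re + s * (C.groundStateFunctional B).re := by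
  rw [map_add, LinearMap.map_smul_of_tower, LinearMap.map_smul_of_tower]
  simp [Complex.add_re]

/-- **Concavity of the ground energy.** For Hermitian `A`, `B` and `t, s ≥ 0` with `t + s = 1`:
`t E₀(A) + s E₀(B) ≤ E₀(t A + s B)` (the ground energy of the mixture is evaluated by its own tracial
ground state `ω`, which is a trial state for `A` and for `B`). Tasaki (2020) §2.1 (variational
principle). [folklore] -/
theorem groundEnergy_convexCombo_ge {A B : Matrix n n ℂ} (hA : A.IsHermitian) (hB : B.IsHermitian)
    [Nonempty n] {t s : ℝ} (ht : 0 ≤ t) (hs : 0 ≤ s) :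
    t * A.groundEnergy + s * B.groundEnergy ≤ (t • A + s • B).groundEnergy := by
  set C : Matrix n n ℂ := t • A + s • B with hC
  have hCh : C.IsHermitian := isHermitian_convexCombo hA hB t s
  have hCC : ((C.groundStateFunctional C).re : ℝ) = C.groundEnergy := by
    rw [groundStateFunctional_hamiltonian hCh, Complex.ofReal_re]
  have hsplit := groundStateFunctional_re_convexCombo C A B t s
  have hA' : A.groundEnergy ≤ (C.groundStateFunctional A).re :=
    groundEnergy_le_groundStateFunctional_re hCh hA
  have hB' : B.groundEnergy ≤ (C.groundStateFunctional B).re :=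
    groundEnergy_le_groundStateFunctional_re hCh hB
  have := add_le_add (mul_le_mul_of_nonneg_left hA' ht) (mul_le_mul_of_nonneg_left hB' hs)
  rw [← hsplit, hCC] at this
  exact this

/-- **Tangent (Hellmann–Feynman) hyperplane bound.** Along an affine dial family with Hermitian
`A`, `P i` and real dials `x`: `E₀(A + ∑ xᵢ Pᵢ) ≤ E₀(A) + ∑ xᵢ · re ω_A(Pᵢ)`, `ω_A` the tracial
ground-state functional of `A` (trial state = ground state of `A`). [folklore] -/
theorem groundEnergy_affineDial_le_tangent {ι : Type*} (S : Finset ι) {A : Matrix n n ℂ}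
    (hA : A.IsHermitian) {P : ι → Matrix n n ℂ} (hP : ∀ i, (P i).IsHermitian) (x : ι → ℝ)
    [Nonempty n] :
    (A + ∑ i ∈ S, x i • P i).groundEnergy
      ≤ A.groundEnergy + ∑ i ∈ S, x i * (A.groundStateFunctional (P i)).re := by
  have hCh := isHermitian_affineDial S hA hP x
  have hle := groundEnergy_le_groundStateFunctional_re hA hCh
  have hexp : (A.groundStateFunctional (A + ∑ i ∈ S, x i • P i)).re
      = A.groundEnergy + ∑ i ∈ S, x i * (A.groundStateFunctional (P i)).re := by
    rw [map_add, map_sum, groundStateFunctional_hamiltonian hA, Complex.add_re, Complex.ofReal_re,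
      Complex.re_sum]
    congr 1
    refine Finset.sum_congr rfl fun i _ => ?_
    rw [LinearMap.map_smul_of_tower]
    simp
  rw [hexp] at hle
  exact hle

/-- **The first-order onset half-space is exactly sufficient.** If the tangent value is negative,
`E₀(A) + ∑ xᵢ re ω_A(Pᵢ) < 0`, then the dialled matrix has a negative ground level. [folklore] -/
theorem groundEnergy_affineDial_neg_of_tangent_neg {ι : Type*} (S : Finset ι) {A : Matrix n n ℂ}
    (hA : A.IsHermitian) {P : ι → Matrix n n ℂ} (hP : ∀ i, (P i).IsHermitian) (x : ι → ℝ)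
    [Nonempty n] (h : A.groundEnergy + ∑ i ∈ S, x i * (A.groundStateFunctional (P i)).re < 0) :
    (A + ∑ i ∈ S, x i • P i).groundEnergy < 0 :=
  lt_of_le_of_lt (groundEnergy_affineDial_le_tangent S hA hP x) h

/-- Quantitative form used by the look-ahead analysis: if the tangent value is `≤ -m` then the
dialled ground level is `≤ -m` (depth of the onset is at least the first-order depth). [folklore] -/
theorem groundEnergy_affineDial_le_neg_of_tangent_le {ι : Type*} (S : Finset ι) {A : Matrix n n ℂ}
    (hA : A.IsHermitian) {P : ι → Matrix n n ℂ} (hP : ∀ i, (P i).IsHermitian) (x : ι → ℝ)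
    [Nonempty n] {m : ℝ}
    (h : A.groundEnergy + ∑ i ∈ S, x i * (A.groundStateFunctional (P i)).re ≤ -m) :
    (A + ∑ i ∈ S, x i • P i).groundEnergy ≤ -m :=
  (groundEnergy_affineDial_le_tangent S hA hP x).trans h

end Summit.RiemannHypothesis.RiemannHypothesis.Theorems.PfPersistenceDialConcavity
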